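import Summits.QuantumFields.GaugeBoot.ClassB
import Literature.MathematicalPhysics.QuantumFieldTheory.StrongCouplingActivities
import HarnessLib

/-!
# Haar-shift (one-link DLR) states have full support on cylinder sets (gauge-boot, Class B)

HONEST FRAMING (cell `pub-gaugeboot`, page 1 of every file): the venture produces certified bounds
on lattice expectations at stated coupling, gauge group, dimension and torus size; NOT a mass gap,
NOT a continuum limit, NOT a string tension; NOT Yang–Mills-summit-bearing (barriers
`FixedCouplingUltralocality`, `PerturbativeInvisibility`). Structural lemma for the Class-B column
(SCOPING A18); certifies no number.

## Content

`IsHaarShiftState ρ β μ` (`ClassB.lean`) is the one-link Gibbs identity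
`∫ f(U[e ↦ g·U_e]) dμ = ∫ f(U) · exp(-β (S_e(U[e ↦ g⁻¹·U_e]) - S_e(U))) dμ` for continuous cylinder
observables `f`. Whatever `β` and `ρ`, it makes the class of `μ`-null continuous cylinder
observables invariant under all one-link left shifts, hence under Haar averaging of finitely many
links, whence:

* `IsHaarShiftState.integral_comp_update_eq_zero` — if `f ≥ 0` is a continuous cylinder
  observable with `∫ f dμ = 0`, then `∫ f(U[e ↦ g·U_e]) dμ = 0` for every link `e` and `g ∈ G`;
* `IsHaarShiftState.integral_comp_glueMul_eq_zero` — the same for the simultaneous shift of the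
  links of a finite set `T`, `U ↦ glueWith T (x ↦ c_x · U_x) U`;
* ★ **`IsHaarShiftState.eq_zero_of_integral_eq_zero`** — `G` compact metrisable, `μ ≠ 0` finite:
  a non-negative continuous cylinder observable with `∫ f dμ = 0` VANISHES IDENTICALLY (product
  Haar measure charges every non-empty open set of `G^T`);
* `IsHaarShiftState.integral_pos_of_pos` — hence `∫ f dμ > 0` as soon as such an `f` is positive
  somewhere.

Used by `ClassBNegativeCouplingEmpty.lean` (no Class-B state exists at `β < 0`). All [folklore]
(Georgii, *Gibbs Measures and Phase Transitions*, 2nd ed. 2011, §1.2–§2.1: DLR states are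
quasi-invariant under local modifications).
-/

open MeasureTheory Filter Function
open scoped ENNReal

namespace Summit.QuantumFields.GaugeBoot

open Literature.MathematicalPhysics.QuantumFieldTheory (haarProbability)
open Literature.MathematicalPhysics.QuantumLattice
open Literature.Probability.LatticeModels (glueWith glueWith_apply_mem glueWith_apply_not_mem)

noncomputable section

variable {d N : ℕ} {G : Type*} [Group G] [TopologicalSpace G] [IsTopologicalGroup G]
  [CompactSpace G] [MeasurableSpace G] [BorelSpace G] [SecondCountableTopology G]
  (ρ : G →* Matrix (Fin N) (Fin N) ℂ)

/-! ## Closure properties of continuous cylinder observables -/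

omit [IsTopologicalGroup G] [CompactSpace G] [MeasurableSpace G] [BorelSpace G]
  [SecondCountableTopology G] in
/-- The simultaneous shift of the links of `T`, `U ↦ glueWith T (x ↦ c_x · U_x) U`, is continuous. -/
theorem continuous_glueMul [ContinuousMul G] (T : Finset (ZdEdge d)) (c : ZdEdge d → G) :
    Continuous fun U : LGConfig d G => glueWith T (fun x : ↥T => c x * U x) U := by
  refine continuous_pi fun x => ?_
  by_cases hx : x ∈ T
  · simp only [glueWith_apply_mem _ _ _ hx]
    exact continuous_const.mul (continuous_apply _)
  · simp only [glueWith_apply_not_mem _ _ _ hx]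
    exact continuous_apply x

omit [TopologicalSpace G] [IsTopologicalGroup G] [CompactSpace G] [MeasurableSpace G] [BorelSpace G]
  [SecondCountableTopology G] in
/-- A cylinder observable composed with the simultaneous shift is a cylinder observable. -/
theorem isCylinder_comp_glueMul {α : Type*} {f : LGConfig d G → α} {S : Finset (ZdEdge d)}
    (hf : IsCylinder f S) (T : Finset (ZdEdge d)) (c : ZdEdge d → G) :
    IsCylinder (fun U : LGConfig d G => f (glueWith T (fun x : ↥T => c x * U x) U)) (S ∪ T) := by
  intro U V hUV
  refine hf fun x hx => ?_
  by_cases hxT : x ∈ T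
  · simp only [glueWith_apply_mem _ _ _ hxT, hUV x (Finset.mem_union_right _ hxT)]
  · simp only [glueWith_apply_not_mem _ _ _ hxT, hUV x (Finset.mem_union_left _ hx)]

omit [TopologicalSpace G] [IsTopologicalGroup G] [CompactSpace G] [MeasurableSpace G] [BorelSpace G]
  [SecondCountableTopology G] in
/-- Adding one more link to the simultaneous shift is a one-link shift beforehand (`e ∉ T`). -/
theorem glueMul_insert {T : Finset (ZdEdge d)} {e : ZdEdge d} (he : e ∉ T) (c : ZdEdge d → G)
    (U : LGConfig d G) :
    glueWith (insert e T) (fun x : ↥(insert e T) => c x * U x) U =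
      glueWith T (fun x : ↥T => c x * (Function.update U e (c e * U e)) x)
        (Function.update U e (c e * U e)) := by
  funext x
  by_cases hxe : x = e
  · subst hxe
    simp only [glueWith_apply_mem _ _ _ (Finset.mem_insert_self x T), Function.update_self,
      glueWith_apply_not_mem _ _ _ he]
  · by_cases hxT : x ∈ T
    · simp only [glueWith_apply_mem _ _ _ (Finset.mem_insert_of_mem hxT),
        glueWith_apply_mem _ _ _ hxT, Function.update_of_ne hxe]
    · have hx' : x ∉ insert e T := by simp [hxe, hxT]
      simp only [glueWith_apply_not_mem _ _ _ hx', glueWith_apply_not_mem _ _ _ hxT,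
        Function.update_of_ne hxe]

omit [Group G] [IsTopologicalGroup G] [MeasurableSpace G] [BorelSpace G] [SecondCountableTopology G] in
/-- A continuous real observable of the compact configuration space is bounded. -/
theorem exists_bound_of_continuous {f : LGConfig d G → ℝ} (hf : Continuous f) :
    ∃ C : ℝ, ∀ U, ‖f U‖ ≤ C := by
  obtain ⟨C, hC⟩ := isCompact_univ.exists_bound_of_continuousOn hf.continuousOn
  exact ⟨C, fun U => hC U (Set.mem_univ U)⟩

omit [Group G] [IsTopologicalGroup G] in
/-- A continuous real observable is integrable for every finite measure (compact metrisable
configuration space). -/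
theorem integrable_of_continuous_real {f : LGConfig d G → ℝ} (hf : Continuous f)
    (μ : Measure (LGConfig d G)) [IsFiniteMeasure μ] : Integrable f μ := by
  obtain ⟨C, hC⟩ := exists_bound_of_continuous hf
  exact Integrable.of_bound hf.measurable.aestronglyMeasurable C (ae_of_all _ hC)

/-! ## Null continuous cylinder observables are shift invariant -/

namespace IsHaarShiftState

variable {ρ} {β : ℝ} {μ : Measure (LGConfig d G)}

omit [IsTopologicalGroup G] in
/-- **One link.** For a Haar-shift state, a non-negative continuous cylinder observable with
`∫ f dμ = 0` still has `∫ f(U[e ↦ g·U_e]) dμ = 0` after any one-link left shift. -/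
theorem integral_comp_update_eq_zero [IsFiniteMeasure μ] (hμ : IsHaarShiftState ρ β μ)
    (e : ZdEdge d) (g : G) {f : LGConfig d G → ℝ} {S : Finset (ZdEdge d)} (hfS : IsCylinder f S)
    (hfc : Continuous f) (hf0 : ∀ U, 0 ≤ f U) (hint : ∫ U, f U ∂μ = 0) :
    ∫ U, f (Function.update U e (g * U e)) ∂μ = 0 := by
  rw [hμ e g f S hfS hfc]
  have hae : f =ᵐ[μ] 0 :=
    (integral_eq_zero_iff_of_nonneg (fun U => hf0 U) (integrable_of_continuous_real hfc μ)).1 hint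
  refine integral_eq_zero_of_ae ?_
  filter_upwards [hae] with U hU
  simp [hU]

/-- **Finitely many links.** The same for the simultaneous shift of the links of a finite set `T`
by arbitrary group elements `c_x`. -/
theorem integral_comp_glueMul_eq_zero [IsFiniteMeasure μ] (hμ : IsHaarShiftState ρ β μ)
    {f : LGConfig d G → ℝ} {S : Finset (ZdEdge d)} (hfS : IsCylinder f S) (hfc : Continuous f)
    (hf0 : ∀ U, 0 ≤ f U) (hint : ∫ U, f U ∂μ = 0) (c : ZdEdge d → G) (T : Finset (ZdEdge d)) :
    ∫ U, f (glueWith T (fun x : ↥T => c x * U x) U) ∂μ = 0 := by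
  classical
  induction T using Finset.induction_on with
  | empty =>
    have h : ∀ U : LGConfig d G, glueWith (∅ : Finset (ZdEdge d))
        (fun x : ↥(∅ : Finset (ZdEdge d)) => c x * U x) U = U :=
      fun U => funext fun x => glueWith_apply_not_mem _ _ _ (Finset.notMem_empty x)
    simp only [h]
    exact hint
  | insert e T he ih =>
    simp only [glueMul_insert he]
    exact integral_comp_update_eq_zero hμ e (c e)
      (f := fun V : LGConfig d G => f (glueWith T (fun x : ↥T => c x * V x) V))
      (isCylinder_comp_glueMul hfS T c) (hfc.comp (continuous_glueMul T c)) (fun U => hf0 _) ih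

/-- ★ **Haar-shift states charge every cylinder: a non-negative continuous cylinder observable with
zero mean vanishes identically.** `G` compact metrisable, `μ` a non-zero finite measure with the
one-link Haar-shift property (any `β`, any `ρ`), `f ≥ 0` continuous with `IsCylinder f S` and
`∫ f dμ = 0`: then `f = 0`. (Shift the links of `S` by Haar-distributed group elements: by right
invariance the average no longer depends on `U`, and product Haar measure on `G^S` charges every
non-empty open set.) -/
theorem eq_zero_of_integral_eq_zero [IsFiniteMeasure μ] [NeZero μ] (hμ : IsHaarShiftState ρ β μ)
    {f : LGConfig d G → ℝ} {S : Finset (ZdEdge d)} (hfS : IsCylinder f S) (hfc : Continuous f)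
    (hf0 : ∀ U, 0 ≤ f U) (hint : ∫ U, f U ∂μ = 0) : f = 0 := by
  classical
  -- Haar on the links of `S`
  set π : Measure (↥S → G) := Measure.pi fun _ : ↥S => haarProbability G with hπ
  haveI : IsProbabilityMeasure π := by rw [hπ]; infer_instance
  haveI : π.IsOpenPosMeasure := by
    rw [hπ]; haveI : (haarProbability G).IsOpenPosMeasure := by
      unfold haarProbability; infer_instance
    infer_instance
  -- the shifted observable as a function of (group elements, configuration)
  set F : (↥S → G) → LGConfig d G → ℝ :=
    fun c U => f (glueWith S (fun x : ↥S => c x * U x) U) with hF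
  -- (1) for every `c`, `∫ F c dμ = 0`
  have h1 : ∀ c : ↥S → G, ∫ U, F c U ∂μ = 0 := fun c => by
    have h := integral_comp_glueMul_eq_zero hμ hfS hfc hf0 hint (glueWith S c 1) S
    have hc : ∀ U : LGConfig d G, glueWith S (fun x : ↥S => glueWith S c (1 : LGConfig d G) x * U x) U
        = glueWith S (fun x : ↥S => c x * U x) U := fun U => by
      congr 1
      funext x
      rw [glueWith_apply_mem _ _ _ x.2]
    simp only [hc] at h
    exact h
  -- (2) joint continuity, hence measurability, of `F`
  have hFc : Continuous (uncurry F) := by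
    refine hfc.comp (continuous_pi fun x => ?_)
    by_cases hx : x ∈ S
    · simp only [glueWith_apply_mem _ _ _ hx]
      exact ((continuous_apply _).comp continuous_fst).mul ((continuous_apply x).comp continuous_snd)
    · simp only [glueWith_apply_not_mem _ _ _ hx]
      exact (continuous_apply x).comp continuous_snd
  have hF0 : ∀ c U, 0 ≤ F c U := fun c U => hf0 _
  have hFcU : ∀ c, Continuous fun U => F c U := fun c =>
    hFc.comp (continuous_const.prodMk continuous_id)
  -- (3) Tonelli: `∫⁻ (∫⁻ F dπ) dμ = ∫⁻ (∫⁻ F dμ) dπ = 0`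
  have hFm : Measurable (uncurry fun U c => ENNReal.ofReal (F c U)) :=
    (ENNReal.measurable_ofReal.comp hFc.measurable).comp measurable_swap
  have h3 : ∫⁻ U, ∫⁻ c, ENNReal.ofReal (F c U) ∂π ∂μ = 0 := by
    rw [lintegral_lintegral_swap hFm.aemeasurable]
    rw [lintegral_congr fun c => ?_, lintegral_zero]
    show ∫⁻ U, ENNReal.ofReal (F c U) ∂μ = 0
    rw [← ofReal_integral_eq_lintegral_ofReal
      (integrable_of_continuous_real (hFcU c) μ)
      (ae_of_all _ fun U => hF0 c U)]
    simp only [hF] at h1 ⊢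
    rw [h1 c, ENNReal.ofReal_zero]
  -- (4) the inner integral does not depend on `U` (right invariance of Haar + cylinder property)
  set φ : (↥S → G) → ℝ := fun c => f (glueWith S c (1 : LGConfig d G)) with hφ
  have hφc : Continuous φ := by
    refine hfc.comp (continuous_pi fun x => ?_)
    by_cases hx : x ∈ S
    · simp only [glueWith_apply_mem _ _ _ hx]; exact continuous_apply _
    · simp only [glueWith_apply_not_mem _ _ _ hx]; exact continuous_const
  have h4 : ∀ U : LGConfig d G,
      ∫⁻ c, ENNReal.ofReal (F c U) ∂π = ∫⁻ c, ENNReal.ofReal (φ c) ∂π := by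
    intro U
    have hT : MeasurePreserving (fun c : ↥S → G => fun x : ↥S => c x * U x) π π := by
      rw [hπ]
      exact measurePreserving_pi (fun _ : ↥S => haarProbability G) (fun _ : ↥S => haarProbability G)
        (f := fun (x : ↥S) (g : G) => g * U x)
        fun x => measurePreserving_mul_right (haarProbability G) (U x)
    have hmeas : Measurable fun c : ↥S → G => ENNReal.ofReal (φ c) :=
      ENNReal.measurable_ofReal.comp hφc.measurable
    rw [← hT.lintegral_comp hmeas]
    refine lintegral_congr fun c => ?_
    simp only [hF, hφ]
    congr 1
    exact hfS fun x hx => by simp only [glueWith_apply_mem _ _ _ hx]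
  -- (5) hence `∫⁻ φ dπ = 0`, so `φ = 0`
  have h5 : ∫⁻ c, ENNReal.ofReal (φ c) ∂π = 0 := by
    have h := h3
    simp only [h4, lintegral_const] at h
    rcases mul_eq_zero.1 h with h0 | h0
    · exact h0
    · exact absurd h0 (Measure.measure_univ_ne_zero.2 (NeZero.ne μ))
  have hφ0 : φ = 0 := by
    have hae : (fun c => ENNReal.ofReal (φ c)) =ᵐ[π] 0 :=
      (lintegral_eq_zero_iff (ENNReal.measurable_ofReal.comp hφc.measurable)).1 h5
    have hae' : φ =ᵐ[π] 0 := by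
      filter_upwards [hae] with c hc
      have h0 : φ c ≤ 0 := ENNReal.ofReal_eq_zero.1 hc
      exact le_antisymm h0 (hf0 _)
    exact (Continuous.ae_eq_iff_eq π hφc continuous_const).1 hae'
  -- (6) `f V = φ (V|_S) = 0`
  funext V
  have hV : f V = φ (fun x : ↥S => V x) :=
    hfS fun x hx => by simp only [glueWith_apply_mem _ _ _ hx]
  rw [hV, hφ0, Pi.zero_apply, Pi.zero_apply]

/-- ★ **Positivity.** A non-negative continuous cylinder observable which is positive at ONE
configuration has positive mean in every non-zero Haar-shift state. -/
theorem integral_pos_of_pos [IsFiniteMeasure μ] [NeZero μ] (hμ : IsHaarShiftState ρ β μ)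
    {f : LGConfig d G → ℝ} {S : Finset (ZdEdge d)} (hfS : IsCylinder f S) (hfc : Continuous f)
    (hf0 : ∀ U, 0 ≤ f U) {U₀ : LGConfig d G} (hU₀ : 0 < f U₀) : 0 < ∫ U, f U ∂μ := by
  have h0 : 0 ≤ ∫ U, f U ∂μ := integral_nonneg fun U => hf0 U
  rcases h0.lt_or_eq with h | h
  · exact h
  · exfalso
    have hf := eq_zero_of_integral_eq_zero hμ hfS hfc hf0 h.symm
    rw [hf] at hU₀
    exact lt_irrefl _ hU₀

end IsHaarShiftState

end

end Summit.QuantumFields.GaugeBoot
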